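import Literature.AnabelianGeometry.EtaleTheta.Discharge.Sec5Thm56OfBiKummerDataAllLeaves
import Literature.AnabelianGeometry.EtaleTheta.Discharge.Sec5KummerRootEquivariance

/-!
# [EtTh] Prop. 5.5 ⊕ Thm. 5.6 (i) at the GENUINE §5 data — consolidation v3a: the base shadow and the Frobenius transport of `Ψ`
# at `A_N` PRODUCED from the model hypotheses ([FrdI] Thm. 3.4 (iii)/(v))

Mochizuki, *The étale theta function and its Frobenioid-theoretic manifestations*, Publ. RIMS **45** (2009)
[cite: MochizukiEtTh2009, Prop 5.5 p.327 (PDF p.101); Thm 5.6 p.328 (PDF p.102)]; Mochizuki, *The geometry of Frobenioids I*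
(2008), Thm. 3.4 (iii), (v) pp.62–63 [cite: MochizukiFrdI2008, Thm. 3.4 (v) p.63].  abc-iut cell, layer L2, row K4
«SUBDAG-Thm56 CONSOLIDATION v3» (abc-iut-L2-lead ROWS #13-addendum R153; seat abc-iut-w5-d034, successor of abc-iut-w5-d020 as
custodian of plan/L2/SUBDAG-EtTh-Thm56.md).  PROOF-ONLY (no definition, no new named fact).

One node-closer for the cone nodes `EtTh:Prop5.5` + `EtTh:Thm5.6(i)` at abc-iut-L2-t4's assembled §5 data
`𝔉 := ThetaFrobenioid.ofBiKummerData …` (W3-L2-01): abc-iut-w5-d020's v2 knit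
`exists_rigidityFamily_unique_preserved_ofBiKummerData_of_leaves` (p428546) with the six Ψ-transport binders at `A_N` —
the base shadow `θ` of `Ψ` through `α` with its law `hθ` ([EtTh] Thm. 4.4 (i): the `1`-compatible `Ψ^bs`) and the Frobenius
transport `Ψ^{ℕ≥1}` with `hdeg`, `hbi`, `hft` ([FrdI] Thm. 3.4 (iii)) — CONSOLIDATED into ONE existential binder `hpsi` («these data EXIST»), which is VERBATIM the conclusion of abc-iut-w5-d245's
`exists_psiTransportData_ofBiKummerData` (p428815: PRODUCED from the model hypotheses base of FSM-type, slim, `Φ` non-dilating,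
`C` not group-like — [EtTh] Thm. 3.7 (i)(ii); its module awaits a parent olean at filing time, so the 20-line sequel
`Sec5Thm56OfBiKummerDataAllLeavesV3Model.lean` discharges `hpsi` by that single term — abc-iut-L2-lead ruling «(ii)» 07:52:32Z).
Since `θ` is existential, the
Prop. 2.4 / T56-L02 / T56-L09c data of its GALOIS SHADOW `γ` ([SemiAnbd] Prop. 3.2: the outer automorphism of `Π^tp_X` induced by
`Ψ^bs`) are quantified over every `θ` satisfying the base-shadow law `hθ` (which determines `θ` on `Aut_D(A_N^bs) = Base(σ(·))`):
the single binder `hΓ`.  The NORMALISED Thm. 5.7 transport `(α, β, D_p₀)` (`D_c = 1`) stays a binder exactly as in v2 (abc-iut-w5-d245's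
`…_model` variant hides `D_c`, which is not asserted to be a unit, so the Δ-transport law could not be moved along it); the section
pair `(σ, φ)` with `hσ`, `hφ`, `hc` stays until the R149 σ-theorem lands (v3b).  Every other leaf is plugged BY NAME as in v2.
Residual binders: v2's list MINUS {θA, hθ, ΨN, hdeg, hbi, hft} PLUS the single binder `hpsi`; the second theorem
`…_of_leaves_model_of_dictionary` moreover DERIVES `hKR` (GAP G-L6t23-3) by abc-iut-L2-t11's dictionary route (p429883,
`hKR_ofBiKummerData_of_dictionary`) from {Facts `H`, the cyclotome dictionary `m`, the theta-section compatibility of the pinned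
cocycle `η₀` (F-0521), the cyclotomic-character compatibility (F-1306), coverage at `H_{B_N}`, `IdentifiesPiYdd`}.
HONEST FRAMING: kernel-checked implications between typed statements about the assembled §5 data; nothing asserts that such data
exist for an actual curve; typed ≠ discharged; no side taken on [IUTchIII] Cor. 3.12.
-/

noncomputable section

namespace Literature.AnabelianGeometry.EtaleTheta

open CategoryTheory Opposite FrobenioidCyclotomicRigidity Literature.AlgebraicGeometry.Frobenioids

universe u₀ v₀ u v w v₁ u₁

namespace ThetaFrobenioid

section Data


variable {K : Type u₀} [Field K]
  {X : SemiGraphs.TemperedArithmeticGroup.{u₀} K} {D₀ : Type u₀} [Category.{v₀} D₀]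
  {V : FrdIMonoidStub.{w}} {T₀ : RealifiedDivisorMonoids (D₀ := D₀) V} {D : Type u} [Category.{v} D]
  {VD : FrdICatStub.{u, v, w} D} {S : BiKummerSetting X T₀ D VD}
  {pullFrac : ∀ {A A' : S.C} (_ : A' ⟶ A), S.biratUnits A → S.biratUnits A'}
  {lv N : ℕ+} {l' : ℕ} {RD : RigidData.{max v w} N l'} {θ : S.biratUnits S.Aodot} {Bl : S.C}
  {Pl : S.FractionPair θ Bl} {Rl : S.NthRoot θ Pl lv pullFrac}
  (h : ModelFrobenioid.Hypotheses S.tf.divisorMonoid S.tf.ratFnFunctor)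
  (toB : ∀ A : S.C, S.biratUnits A →* S.tf.biratUnitsModel A) (Q : FrobenioidTheta.ThetaSubquotientStub.{w} D)
  (odd_l : Odd (lv : ℕ)) (R : S.NthRoot Rl.root Rl.pair N pullFrac) (ιX : RD.PiX ≃ₜ* X.Pi)
  (hopen : IsOpen ((S.galoisSurj R.AN.base R.αData.isGalois).ker : Set X.Pi)) (σ : Aut R.AN.base →* Aut R.AN)
  (K' : Type w) [Field K'] (constEmb : K'ˣ →* S.tf.biratUnitsModel R.BN)
  (constEmb_injective : Function.Injective constEmb)
  (hdivc : ∀ g : Aut R.BN.base,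
    ModelFrobenioid.div ((σ ((BiKummerSetting.NthRoot.baseIso S R).conjAut.symm g)).hom ≫ R.pair.num) =
      ModelFrobenioid.div R.pair.num)
  (hdivp : ∀ y : RD.PiYdd,
    ModelFrobenioid.div ((σ (S.galoisSurj R.AN.base R.αData.isGalois (ιX y.1))).hom ≫ R.pair.den) =
      ModelFrobenioid.div R.pair.den)

/-- **[EtTh] Prop. 5.5 ⊕ Thm. 5.6 (i) AT THE GENUINE §5 DATA, base shadow and Frobenius transport of `Ψ` PRODUCED** (v3a of the
K4 consolidation): as abc-iut-w5-d020's `exists_rigidityFamily_unique_preserved_ofBiKummerData_of_leaves`, but the binders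
`θA, hθ, ΨN, hdeg, hbi, hft` are replaced by the ONE existential binder `hpsi` (= the conclusion of abc-iut-w5-d245's
`exists_psiTransportData_ofBiKummerData`, [FrdI] Thm. 3.4 (iii)/(v) at the model), and the Galois-shadow data `γ` (Prop. 2.4,
T56-L02, T56-L09c) are supplied for the existential base shadow through `hΓ`.  [cite: MochizukiEtTh2009, Thm 5.6 p.328 (PDF p.102)] -/
theorem exists_rigidityFamily_unique_preserved_ofBiKummerData_of_leaves_model
    -- Prop 5.5 side (η / ν pin, reachability, stub laws)
    (hB : (ofBiKummerData h toB Q odd_l R ιX hopen σ K' constEmb constEmb_injective hdivc hdivp).IsThetaSaturated (ofBiKummerData h toB Q odd_l R ιX hopen σ K' constEmb constEmb_injective hdivc hdivp).BN) (P : ThetaSubquotientProj (ofBiKummerData h toB Q odd_l R ιX hopen σ K' constEmb constEmb_injective hdivc hdivp))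
    {η₀ : RD.PiYdd → RD.mu} (hη₀ : η₀ ∈ RD.thetaCocycles)
    (hdies : ∀ k : RD.PiYdd, rhoOfBiKummerData R ιX k = 1 → η₀ k = 1)
    (e : RD.mu → (ofBiKummerData h toB Q odd_l R ιX hopen σ K' constEmb constEmb_injective hdivc hdivp).lDeltaModN (ofBiKummerData h toB Q odd_l R ιX hopen σ K' constEmb constEmb_injective hdivc hdivp).BN) (he : Function.Surjective e)
    (hpre : ∀ k : RD.PiYdd, (k : RD.PiX) ∈ RD.lDeltaTheta → rhoOfBiKummerData R ιX k ∈ P.pre _)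
    (hP : ∀ (k : RD.PiYdd) (hk : (k : RD.PiX) ∈ RD.lDeltaTheta) (hm : rhoOfBiKummerData R ιX k ∈ P.pre _),
      (QuotientGroup.mk (P.proj _ ⟨rhoOfBiKummerData R ιX k, hm⟩) : (ofBiKummerData h toB Q odd_l R ιX hopen σ K' constEmb constEmb_injective hdivc hdivp).lDeltaModN (ofBiKummerData h toB Q odd_l R ιX hopen σ K' constEmb constEmb_injective hdivc hdivp).BN) = e (RD.thetaMod ⟨k, hk⟩))
    (hcov' : ∀ g ∈ P.pre ((ofBiKummerData h toB Q odd_l R ιX hopen σ K' constEmb constEmb_injective hdivc hdivp).base.obj (ofBiKummerData h toB Q odd_l R ιX hopen σ K' constEmb constEmb_injective hdivc hdivp).BN), ∃ k : RD.PiYdd, (k : RD.PiX) ∈ RD.lDeltaTheta ∧ rhoOfBiKummerData R ιX k = g)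
    (ν : (ofBiKummerData h toB Q odd_l R ιX hopen σ K' constEmb constEmb_injective hdivc hdivp).lDeltaModN (ofBiKummerData h toB Q odd_l R ιX hopen σ K' constEmb constEmb_injective hdivc hdivp).BN ≃* (ofBiKummerData h toB Q odd_l R ιX hopen σ K' constEmb constEmb_injective hdivc hdivp).muTorsion (ofBiKummerData h toB Q odd_l R ιX hopen σ K' constEmb constEmb_injective hdivc hdivp).BN (ofBiKummerData h toB Q odd_l R ιX hopen σ K' constEmb constEmb_injective hdivc hdivp).N)
    (hKν : ∀ η : (ofBiKummerData h toB Q odd_l R ιX hopen σ K' constEmb constEmb_injective hdivc hdivp).HB → (ofBiKummerData h toB Q odd_l R ιX hopen σ K' constEmb constEmb_injective hdivc hdivp).lDeltaModN (ofBiKummerData h toB Q odd_l R ιX hopen σ K' constEmb constEmb_injective hdivc hdivp).BN,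
      (∀ k : RD.PiYdd, η ⟨rhoOfBiKummerData R ιX k, Subgroup.mem_map_of_mem _ k.2⟩ = e (η₀ k)) →
        FrobenioidThetaBiKummer.ThetaPairKummerClass (ofBiKummerData h toB Q odd_l R ιX hopen σ K' constEmb constEmb_injective hdivc hdivp) η ν)
    (hσ : ∀ g : Aut R.AN.base, ModelFrobenioid.baseMap (σ g).hom = g.hom)
    (hgeom : P.pre R.BN.base ≤ RD.aug.ker.map (rhoOfBiKummerData R ιX))
    -- T56-L09b: Prop 3.4 (ii) constants + the origin clause «cnst kills Ker aug» (G-w5d020-2)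
    {Dcnst : Type u₁} [Category.{v₁} Dcnst] {cnst : D₀ ⥤ Dcnst} (hP34 : RealifiedDivisorMonoids.Prop34Cnst T₀ cnst)
    (hΔcnst : ∀ δ ∈ RD.aug.ker,
      cnst.map (S.tf.base.map (rhoOfBiKummerData R ιX δ).hom) = 𝟙 (cnst.obj (S.tf.base.obj R.BN.base)))
    (hreach : LinearlyReachableFromBN (ofBiKummerData h toB Q odd_l R ιX hopen σ K' constEmb constEmb_injective hdivc hdivp))
    (hLc : Thm56Sub.LDeltaMapComp (ofBiKummerData h toB Q odd_l R ιX hopen σ K' constEmb constEmb_injective hdivc hdivp)) (hLi : Thm56Sub.LDeltaMapId (ofBiKummerData h toB Q odd_l R ιX hopen σ K' constEmb constEmb_injective hdivc hdivp))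
    -- P55-L06 leaves: (G) as the base law, hproj named, hcup as the pull-root law of abc-iut-L6-t23
    (hGalT : ∀ ⦃A : D⦄, S.IsGaloisObj A → ∀ ⦃T : D⦄ (b b' : A ⟶ T), ∃ g : Aut A, b' = g.hom ≫ b)
    (hproj : ∀ (g g' : Aut ((ofBiKummerData h toB Q odd_l R ιX hopen σ K' constEmb constEmb_injective hdivc hdivp).base.obj (ofBiKummerData h toB Q odd_l R ιX hopen σ K' constEmb constEmb_injective hdivc hdivp).BN)) (hh : g' ∈ P.pre _), ∃ hgh : g * g' * g⁻¹ ∈ P.pre _,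
      (ofBiKummerData h toB Q odd_l R ιX hopen σ K' constEmb constEmb_injective hdivc hdivp).lDeltaMap g.hom (P.proj _ ⟨g', hh⟩) = P.proj _ ⟨g * g' * g⁻¹, hgh⟩)
    (hKR : ∀ (y₀ y : RD.PiX), y ∈ RD.PiYdd → rhoOfBiKummerData R ιX y ∈ P.pre R.BN.base →
      pull S.tf.ratFnFunctor (S.galoisSurj R.AN.base R.αData.isGalois (ιX y)).hom
          (pull S.tf.ratFnFunctor (S.galoisSurj R.AN.base R.αData.isGalois (ιX y₀)).hom
            (toB R.AN R.root : S.tf.ratFnFunctor.obj (op R.AN.base))) *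
          (toB R.AN R.root : S.tf.ratFnFunctor.obj (op R.AN.base)) =
        pull S.tf.ratFnFunctor (S.galoisSurj R.AN.base R.αData.isGalois (ιX y)).hom
            (toB R.AN R.root : S.tf.ratFnFunctor.obj (op R.AN.base)) *
          pull S.tf.ratFnFunctor (S.galoisSurj R.AN.base R.αData.isGalois (ιX y₀)).hom
            (toB R.AN R.root : S.tf.ratFnFunctor.obj (op R.AN.base)))
    -- t4's inputs discharging hdiff ([FrdI] Prop 5.6 section law, Π^tp_Ÿ ⊆ H_⊙, Thm 5.2 (ii) dictionary)
    (hH : ∀ y : RD.PiX, y ∈ RD.PiYdd → ιX y ∈ S.Hodot)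
    (hfrac : ∀ {A B : S.C} (s' s'' : A ⟶ B) (h' : S.IsPreStep s') (h'' : S.IsPreStep s'')
      (hb : PreFrobenioid.BaseEquivalent S.F s' s''),
      (toB A (S.fracOf s' s'' h' h'' hb) : S.tf.ratFnFunctor.obj (op A.base)) *
        ModelFrobenioid.unit s'' = ModelFrobenioid.unit s')
    (haut : ∀ {A : S.C} (e : Aut A) (x : S.biratUnits A),
      (toB A (S.biratAut A e x) : S.tf.ratFnFunctor.obj (op A.base)) =
        pull S.tf.ratFnFunctor (ModelFrobenioid.baseMap e.inv) (toB A x : S.tf.ratFnFunctor.obj (op A.base)))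
    -- Thm 5.6 side: Ψ, its base shadow, Δ-transport and μ-pull data (abc-iut-L2-d4)
    (Ψ : S.C ≌ S.C) (Ψbs : D ⥤ D) [Ψbs.Faithful] (eΨ : Ψ.functor ⋙ (ofBiKummerData h toB Q odd_l R ιX hopen σ K' constEmb constEmb_injective hdivc hdivp).base ≅ (ofBiKummerData h toB Q odd_l R ιX hopen σ K' constEmb constEmb_injective hdivc hdivp).base ⋙ Ψbs)
    (aΨ : ∀ A : S.C, (ofBiKummerData h toB Q odd_l R ιX hopen σ K' constEmb constEmb_injective hdivc hdivp).lDeltaModN A ≃* (ofBiKummerData h toB Q odd_l R ιX hopen σ K' constEmb constEmb_injective hdivc hdivp).lDeltaModN (Ψ.functor.obj A))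
    (hlin : PreFrobenioidData.PreservesMor Ψ.functor (ofBiKummerData h toB Q odd_l R ιX hopen σ K' constEmb constEmb_injective hdivc hdivp).IsLinear (ofBiKummerData h toB Q odd_l R ιX hopen σ K' constEmb constEmb_injective hdivc hdivp).IsLinear)
    (haΨn : ∀ {A A' : S.C} (φ : A ⟶ A') (x : (ofBiKummerData h toB Q odd_l R ιX hopen σ K' constEmb constEmb_injective hdivc hdivp).lDeltaModN A),
      aΨ A' ((ofBiKummerData h toB Q odd_l R ιX hopen σ K' constEmb constEmb_injective hdivc hdivp).lDeltaModNMap φ x) = (ofBiKummerData h toB Q odd_l R ιX hopen σ K' constEmb constEmb_injective hdivc hdivp).lDeltaModNMap (Ψ.functor.map φ) (aΨ A x))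
    (hpull : ∀ {A A' : S.C} (φ : A ⟶ A') (u : (ofBiKummerData h toB Q odd_l R ιX hopen σ K' constEmb constEmb_injective hdivc hdivp).muTorsion A' (ofBiKummerData h toB Q odd_l R ιX hopen σ K' constEmb constEmb_injective hdivc hdivp).N)
      (hu : Ψ.functor.mapAut A' (u : Aut A') ∈ (ofBiKummerData h toB Q odd_l R ιX hopen σ K' constEmb constEmb_injective hdivc hdivp).muTorsion (Ψ.functor.obj A') (ofBiKummerData h toB Q odd_l R ιX hopen σ K' constEmb constEmb_injective hdivc hdivp).N),
      Ψ.functor.mapAut A ((ofBiKummerData h toB Q odd_l R ιX hopen σ K' constEmb constEmb_injective hdivc hdivp).muTorsionPull φ (ofBiKummerData h toB Q odd_l R ιX hopen σ K' constEmb constEmb_injective hdivc hdivp).N u : Aut A) = ((ofBiKummerData h toB Q odd_l R ιX hopen σ K' constEmb constEmb_injective hdivc hdivp).muTorsionPull (Ψ.functor.map φ) (ofBiKummerData h toB Q odd_l R ιX hopen σ K' constEmb constEmb_injective hdivc hdivp).N ⟨_, hu⟩ : Aut (Ψ.functor.obj A)))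
    -- the NORMALISED Thm 5.7 transport (D_c = 1, e = 1: abc-iut-L2-d4 T1 + abc-iut-w5-d245 `capCupTransport_normalise`)
    (α : Ψ.functor.obj (ofBiKummerData h toB Q odd_l R ιX hopen σ K' constEmb constEmb_injective hdivc hdivp).AN ≅ (ofBiKummerData h toB Q odd_l R ιX hopen σ K' constEmb constEmb_injective hdivc hdivp).AN) (β : Ψ.functor.obj (ofBiKummerData h toB Q odd_l R ιX hopen σ K' constEmb constEmb_injective hdivc hdivp).BN ≅ (ofBiKummerData h toB Q odd_l R ιX hopen σ K' constEmb constEmb_injective hdivc hdivp).BN) {Dp₀ : Aut (ofBiKummerData h toB Q odd_l R ιX hopen σ K' constEmb constEmb_injective hdivc hdivp).BN}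
    (hc₁ : α.inv ≫ Ψ.functor.map (ofBiKummerData h toB Q odd_l R ιX hopen σ K' constEmb constEmb_injective hdivc hdivp).sCap ≫ β.hom = (ofBiKummerData h toB Q odd_l R ιX hopen σ K' constEmb constEmb_injective hdivc hdivp).sCap)
    (hp₁ : α.inv ≫ Ψ.functor.map (ofBiKummerData h toB Q odd_l R ιX hopen σ K' constEmb constEmb_injective hdivc hdivp).sCup ≫ β.hom = (ofBiKummerData h toB Q odd_l R ιX hopen σ K' constEmb constEmb_injective hdivc hdivp).sCup ≫ Dp₀.hom) (hDp₀ : Dp₀ ∈ (ofBiKummerData h toB Q odd_l R ιX hopen σ K' constEmb constEmb_injective hdivc hdivp).units (ofBiKummerData h toB Q odd_l R ιX hopen σ K' constEmb constEmb_injective hdivc hdivp).BN)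
    -- [FrdI] Prop 5.6 / Thm 3.4 (iii) data at A_N (abc-iut-w5-d245's Prop 5.6 unit)
    (φ : ℕ+ →* End R.AN)
    (hφ : ∀ n : ℕ+, PreFrobenioid.degFr S.F (End.asHom (φ n)) = n ∧
      PreFrobenioid.IsBaseIdentity S.F (End.asHom (φ n)) ∧ PreFrobenioid.IsFrobeniusType S.F (End.asHom (φ n)))
    (hc : ∀ (n : ℕ+) (g : Aut R.AN.base), (σ g).hom ≫ End.asHom (φ n) = End.asHom (φ n) ≫ (σ g).hom)
    -- the base shadow θ of Ψ through α and the Frobenius transport of Ψ at A_N EXIST ([EtTh] Thm 4.4 (i), [FrdI] Thm 3.4 (iii)):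
    -- ONE binder = VERBATIM the conclusion of abc-iut-w5-d245's `exists_psiTransportData_ofBiKummerData` (p428815),
    -- discharged by that single term in the sequel `…V3Model.lean` once its module is built
    (hpsi : ∃ (θ : Aut R.AN.base ≃* Aut R.AN.base) (ΨN : ℕ+ ≃* ℕ+),
      (∀ f : Aut R.AN, (PreFrobenioid.baseFunctor S.F).mapIso (α.symm ≪≫ Ψ.functor.mapIso f ≪≫ α) =
        θ ((PreFrobenioid.baseFunctor S.F).mapIso f)) ∧
      (∀ f : R.AN ⟶ R.AN, PreFrobenioid.degFr S.F (α.inv ≫ Ψ.functor.map f ≫ α.hom) = ΨN (PreFrobenioid.degFr S.F f)) ∧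
      (∀ f : R.AN ⟶ R.AN, PreFrobenioid.IsBaseIdentity S.F f →
        PreFrobenioid.IsBaseIdentity S.F (α.inv ≫ Ψ.functor.map f ≫ α.hom)) ∧
      (∀ f : R.AN ⟶ R.AN, PreFrobenioid.IsFrobeniusType S.F f →
        PreFrobenioid.IsFrobeniusType S.F (α.inv ≫ Ψ.functor.map f ≫ α.hom)))
    -- Prop 2.4 / T56-L02 / T56-L09c for the Galois shadow of the PRODUCED base shadow of `Ψ` through `α`
    (hΓ : ∀ θA : Aut R.AN.base ≃* Aut R.AN.base,
      (∀ f : Aut R.AN, (PreFrobenioid.baseFunctor S.F).mapIso (α.symm ≪≫ Ψ.functor.mapIso f ≪≫ α) =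
        θA ((PreFrobenioid.baseFunctor S.F).mapIso f)) →
      ∃ γ : RD.PiX ≃ₜ* RD.PiX,
        (∀ y : RD.PiX, (((ofBiKummerData h toB Q odd_l R ιX hopen σ K' constEmb constEmb_injective hdivc hdivp).autBaseIsoAB.symm.trans θA).trans (ofBiKummerData h toB Q odd_l R ιX hopen σ K' constEmb constEmb_injective hdivc hdivp).autBaseIsoAB) (rhoOfBiKummerData R ιX y) =
          rhoOfBiKummerData R ιX (γ y)) ∧
        RD.PiYdd.map γ.toMulEquiv.toMonoidHom = RD.PiYdd ∧
        RD.lDeltaTheta.map γ.toMulEquiv.toMonoidHom = RD.lDeltaTheta ∧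
        ∀ (k : RD.PiYdd) (hk : (k : RD.PiX) ∈ RD.lDeltaTheta) (hk' : γ k ∈ RD.lDeltaTheta),
          (ofBiKummerData h toB Q odd_l R ιX hopen σ K' constEmb constEmb_injective hdivc hdivp).lDeltaModNMap β.hom (aΨ _ (e (RD.thetaMod ⟨k, hk⟩))) = e (RD.thetaMod ⟨γ k, hk'⟩)) :
    ∃ ρ : RigidityFamily (ofBiKummerData h toB Q odd_l R ιX hopen σ K' constEmb constEmb_injective hdivc hdivp), IsKummerDetermined (ofBiKummerData h toB Q odd_l R ιX hopen σ K' constEmb constEmb_injective hdivc hdivp) P ρ hB ∧ IsFunctorialLinear (ofBiKummerData h toB Q odd_l R ιX hopen σ K' constEmb constEmb_injective hdivc hdivp) ρ ∧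
      (∀ ρ' : RigidityFamily (ofBiKummerData h toB Q odd_l R ιX hopen σ K' constEmb constEmb_injective hdivc hdivp), IsKummerDetermined (ofBiKummerData h toB Q odd_l R ιX hopen σ K' constEmb constEmb_injective hdivc hdivp) P ρ' hB → IsFunctorialLinear (ofBiKummerData h toB Q odd_l R ιX hopen σ K' constEmb constEmb_injective hdivc hdivp) ρ' → ρ' = ρ) ∧
      CyclotomicRigidityPreserved (ofBiKummerData h toB Q odd_l R ιX hopen σ K' constEmb constEmb_injective hdivc hdivp) Ψ ρ aΨ := by
  -- the base shadow `θ` of `Ψ` through `α` and the Frobenius transport at `A_N`, PRODUCED at the model (abc-iut-w5-d245)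
  obtain ⟨θA, ΨN, hθ, hdeg, hbi, hft⟩ := hpsi
  -- the Galois shadow of `θ` with its Prop 2.4 / T56-L09c laws
  obtain ⟨γ, hγ, hP24, hγL, haΨ⟩ := hΓ θA hθ
  exact exists_rigidityFamily_unique_preserved_ofBiKummerData_of_leaves h toB Q odd_l R ιX hopen σ K' constEmb constEmb_injective
    hdivc hdivp hB P hη₀ hdies e he hpre hP hcov' ν hKν hσ hgeom hP34 hΔcnst hreach hLc hLi hGalT hproj hKR hH hfrac haut Ψ Ψbs eΨ
    aΨ hlin haΨn hpull α β hc₁ hp₁ hDp₀ φ hφ hc θA hθ ΨN hdeg hbi hft γ hγ hP24 hγL haΨ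

/-- **Variant with `hKR` DERIVED** (GAP G-L6t23-3 closed by abc-iut-L2-t11's `hKR_ofBiKummerData_of_dictionary`, p429883): the
Galois-equivariance of the bi-Kummer root follows from the theta-section compatibility of the pinned cocycle `η₀` ([EtTh] Prop. 5.2 (iii)
/ F-0521 `ThetaSectionCompat`), the cyclotomic-character compatibility and the cyclotome dictionary `m`; all other binders as in
`…_of_leaves_model`.  [cite: MochizukiEtTh2009, Thm 5.6 p.328 (PDF p.102)] -/
theorem exists_rigidityFamily_unique_preserved_ofBiKummerData_of_leaves_model_of_dictionary
    -- Prop 5.5 side (η / ν pin, reachability, stub laws)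
    (hB : (ofBiKummerData h toB Q odd_l R ιX hopen σ K' constEmb constEmb_injective hdivc hdivp).IsThetaSaturated (ofBiKummerData h toB Q odd_l R ιX hopen σ K' constEmb constEmb_injective hdivc hdivp).BN) (P : ThetaSubquotientProj (ofBiKummerData h toB Q odd_l R ιX hopen σ K' constEmb constEmb_injective hdivc hdivp))
    {η₀ : RD.PiYdd → RD.mu} (hη₀ : η₀ ∈ RD.thetaCocycles)
    (hdies : ∀ k : RD.PiYdd, rhoOfBiKummerData R ιX k = 1 → η₀ k = 1)
    (e : RD.mu → (ofBiKummerData h toB Q odd_l R ιX hopen σ K' constEmb constEmb_injective hdivc hdivp).lDeltaModN (ofBiKummerData h toB Q odd_l R ιX hopen σ K' constEmb constEmb_injective hdivc hdivp).BN) (he : Function.Surjective e)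
    (hpre : ∀ k : RD.PiYdd, (k : RD.PiX) ∈ RD.lDeltaTheta → rhoOfBiKummerData R ιX k ∈ P.pre _)
    (hP : ∀ (k : RD.PiYdd) (hk : (k : RD.PiX) ∈ RD.lDeltaTheta) (hm : rhoOfBiKummerData R ιX k ∈ P.pre _),
      (QuotientGroup.mk (P.proj _ ⟨rhoOfBiKummerData R ιX k, hm⟩) : (ofBiKummerData h toB Q odd_l R ιX hopen σ K' constEmb constEmb_injective hdivc hdivp).lDeltaModN (ofBiKummerData h toB Q odd_l R ιX hopen σ K' constEmb constEmb_injective hdivc hdivp).BN) = e (RD.thetaMod ⟨k, hk⟩))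
    (hcov' : ∀ g ∈ P.pre ((ofBiKummerData h toB Q odd_l R ιX hopen σ K' constEmb constEmb_injective hdivc hdivp).base.obj (ofBiKummerData h toB Q odd_l R ιX hopen σ K' constEmb constEmb_injective hdivc hdivp).BN), ∃ k : RD.PiYdd, (k : RD.PiX) ∈ RD.lDeltaTheta ∧ rhoOfBiKummerData R ιX k = g)
    (ν : (ofBiKummerData h toB Q odd_l R ιX hopen σ K' constEmb constEmb_injective hdivc hdivp).lDeltaModN (ofBiKummerData h toB Q odd_l R ιX hopen σ K' constEmb constEmb_injective hdivc hdivp).BN ≃* (ofBiKummerData h toB Q odd_l R ιX hopen σ K' constEmb constEmb_injective hdivc hdivp).muTorsion (ofBiKummerData h toB Q odd_l R ιX hopen σ K' constEmb constEmb_injective hdivc hdivp).BN (ofBiKummerData h toB Q odd_l R ιX hopen σ K' constEmb constEmb_injective hdivc hdivp).N)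
    (hKν : ∀ η : (ofBiKummerData h toB Q odd_l R ιX hopen σ K' constEmb constEmb_injective hdivc hdivp).HB → (ofBiKummerData h toB Q odd_l R ιX hopen σ K' constEmb constEmb_injective hdivc hdivp).lDeltaModN (ofBiKummerData h toB Q odd_l R ιX hopen σ K' constEmb constEmb_injective hdivc hdivp).BN,
      (∀ k : RD.PiYdd, η ⟨rhoOfBiKummerData R ιX k, Subgroup.mem_map_of_mem _ k.2⟩ = e (η₀ k)) →
        FrobenioidThetaBiKummer.ThetaPairKummerClass (ofBiKummerData h toB Q odd_l R ιX hopen σ K' constEmb constEmb_injective hdivc hdivp) η ν)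
    (hσ : ∀ g : Aut R.AN.base, ModelFrobenioid.baseMap (σ g).hom = g.hom)
    (hgeom : P.pre R.BN.base ≤ RD.aug.ker.map (rhoOfBiKummerData R ιX))
    -- T56-L09b: Prop 3.4 (ii) constants + the origin clause «cnst kills Ker aug» (G-w5d020-2)
    {Dcnst : Type u₁} [Category.{v₁} Dcnst] {cnst : D₀ ⥤ Dcnst} (hP34 : RealifiedDivisorMonoids.Prop34Cnst T₀ cnst)
    (hΔcnst : ∀ δ ∈ RD.aug.ker,
      cnst.map (S.tf.base.map (rhoOfBiKummerData R ιX δ).hom) = 𝟙 (cnst.obj (S.tf.base.obj R.BN.base)))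
    (hreach : LinearlyReachableFromBN (ofBiKummerData h toB Q odd_l R ιX hopen σ K' constEmb constEmb_injective hdivc hdivp))
    (hLc : Thm56Sub.LDeltaMapComp (ofBiKummerData h toB Q odd_l R ιX hopen σ K' constEmb constEmb_injective hdivc hdivp)) (hLi : Thm56Sub.LDeltaMapId (ofBiKummerData h toB Q odd_l R ιX hopen σ K' constEmb constEmb_injective hdivc hdivp))
    -- P55-L06 leaves: (G) as the base law, hproj named, hcup as the pull-root law of abc-iut-L6-t23
    (hGalT : ∀ ⦃A : D⦄, S.IsGaloisObj A → ∀ ⦃T : D⦄ (b b' : A ⟶ T), ∃ g : Aut A, b' = g.hom ≫ b)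
    (hproj : ∀ (g g' : Aut ((ofBiKummerData h toB Q odd_l R ιX hopen σ K' constEmb constEmb_injective hdivc hdivp).base.obj (ofBiKummerData h toB Q odd_l R ιX hopen σ K' constEmb constEmb_injective hdivc hdivp).BN)) (hh : g' ∈ P.pre _), ∃ hgh : g * g' * g⁻¹ ∈ P.pre _,
      (ofBiKummerData h toB Q odd_l R ιX hopen σ K' constEmb constEmb_injective hdivc hdivp).lDeltaMap g.hom (P.proj _ ⟨g', hh⟩) = P.proj _ ⟨g * g' * g⁻¹, hgh⟩)
    -- hKR (G-L6t23-3) by abc-iut-L2-t11's dictionary route (p429883): Facts, the cyclotome dictionary m, the theta-section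
    -- compatibility of the pinned cocycle η₀ ([EtTh] Prop 5.2 (iii), F-0521) and the cyclotomic-character compatibility
    (H : (ofBiKummerData h toB Q odd_l R ιX hopen σ K' constEmb constEmb_injective hdivc hdivp).Facts)
    (m : (ofBiKummerData h toB Q odd_l R ιX hopen σ K' constEmb constEmb_injective hdivc hdivp).muTorsion (ofBiKummerData h toB Q odd_l R ιX hopen σ K' constEmb constEmb_injective hdivc hdivp).BN (ofBiKummerData h toB Q odd_l R ιX hopen σ K' constEmb constEmb_injective hdivc hdivp).N ≃* RD.mu)
    (hcompat : ∀ hYdd : (ofBiKummerData h toB Q odd_l R ιX hopen σ K' constEmb constEmb_injective hdivc hdivp).IdentifiesPiYdd RD.toThetaEnvData (MulEquiv.refl _),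
      (ofBiKummerData h toB Q odd_l R ιX hopen σ K' constEmb constEmb_injective hdivc hdivp).ThetaSectionCompat H RD.toThetaEnvData (MulEquiv.refl _) m hYdd η₀)
    (hχX : (ofBiKummerData h toB Q odd_l R ιX hopen σ K' constEmb constEmb_injective hdivc hdivp).CyclotomicCharacterCompatX RD.toThetaEnvData (MulEquiv.refl _) m)
    (hcovHB : ∀ k : (ofBiKummerData h toB Q odd_l R ιX hopen σ K' constEmb constEmb_injective hdivc hdivp).HB, (k : Aut ((ofBiKummerData h toB Q odd_l R ιX hopen σ K' constEmb constEmb_injective hdivc hdivp).base.obj (ofBiKummerData h toB Q odd_l R ιX hopen σ K' constEmb constEmb_injective hdivc hdivp).BN)) ∈ P.pre _ →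
      ∃ (y : RD.PiX) (_ : y ∈ RD.PiYdd), (ofBiKummerData h toB Q odd_l R ιX hopen σ K' constEmb constEmb_injective hdivc hdivp).ρ y = k ∧ y ∈ RD.lDeltaTheta)
    (hYddI : (ofBiKummerData h toB Q odd_l R ιX hopen σ K' constEmb constEmb_injective hdivc hdivp).IdentifiesPiYdd RD.toThetaEnvData (MulEquiv.refl _))
    -- t4's inputs discharging hdiff ([FrdI] Prop 5.6 section law, Π^tp_Ÿ ⊆ H_⊙, Thm 5.2 (ii) dictionary)
    (hH : ∀ y : RD.PiX, y ∈ RD.PiYdd → ιX y ∈ S.Hodot)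
    (hfrac : ∀ {A B : S.C} (s' s'' : A ⟶ B) (h' : S.IsPreStep s') (h'' : S.IsPreStep s'')
      (hb : PreFrobenioid.BaseEquivalent S.F s' s''),
      (toB A (S.fracOf s' s'' h' h'' hb) : S.tf.ratFnFunctor.obj (op A.base)) *
        ModelFrobenioid.unit s'' = ModelFrobenioid.unit s')
    (haut : ∀ {A : S.C} (e : Aut A) (x : S.biratUnits A),
      (toB A (S.biratAut A e x) : S.tf.ratFnFunctor.obj (op A.base)) =
        pull S.tf.ratFnFunctor (ModelFrobenioid.baseMap e.inv) (toB A x : S.tf.ratFnFunctor.obj (op A.base)))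
    -- Thm 5.6 side: Ψ, its base shadow, Δ-transport and μ-pull data (abc-iut-L2-d4)
    (Ψ : S.C ≌ S.C) (Ψbs : D ⥤ D) [Ψbs.Faithful] (eΨ : Ψ.functor ⋙ (ofBiKummerData h toB Q odd_l R ιX hopen σ K' constEmb constEmb_injective hdivc hdivp).base ≅ (ofBiKummerData h toB Q odd_l R ιX hopen σ K' constEmb constEmb_injective hdivc hdivp).base ⋙ Ψbs)
    (aΨ : ∀ A : S.C, (ofBiKummerData h toB Q odd_l R ιX hopen σ K' constEmb constEmb_injective hdivc hdivp).lDeltaModN A ≃* (ofBiKummerData h toB Q odd_l R ιX hopen σ K' constEmb constEmb_injective hdivc hdivp).lDeltaModN (Ψ.functor.obj A))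
    (hlin : PreFrobenioidData.PreservesMor Ψ.functor (ofBiKummerData h toB Q odd_l R ιX hopen σ K' constEmb constEmb_injective hdivc hdivp).IsLinear (ofBiKummerData h toB Q odd_l R ιX hopen σ K' constEmb constEmb_injective hdivc hdivp).IsLinear)
    (haΨn : ∀ {A A' : S.C} (φ : A ⟶ A') (x : (ofBiKummerData h toB Q odd_l R ιX hopen σ K' constEmb constEmb_injective hdivc hdivp).lDeltaModN A),
      aΨ A' ((ofBiKummerData h toB Q odd_l R ιX hopen σ K' constEmb constEmb_injective hdivc hdivp).lDeltaModNMap φ x) = (ofBiKummerData h toB Q odd_l R ιX hopen σ K' constEmb constEmb_injective hdivc hdivp).lDeltaModNMap (Ψ.functor.map φ) (aΨ A x))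
    (hpull : ∀ {A A' : S.C} (φ : A ⟶ A') (u : (ofBiKummerData h toB Q odd_l R ιX hopen σ K' constEmb constEmb_injective hdivc hdivp).muTorsion A' (ofBiKummerData h toB Q odd_l R ιX hopen σ K' constEmb constEmb_injective hdivc hdivp).N)
      (hu : Ψ.functor.mapAut A' (u : Aut A') ∈ (ofBiKummerData h toB Q odd_l R ιX hopen σ K' constEmb constEmb_injective hdivc hdivp).muTorsion (Ψ.functor.obj A') (ofBiKummerData h toB Q odd_l R ιX hopen σ K' constEmb constEmb_injective hdivc hdivp).N),
      Ψ.functor.mapAut A ((ofBiKummerData h toB Q odd_l R ιX hopen σ K' constEmb constEmb_injective hdivc hdivp).muTorsionPull φ (ofBiKummerData h toB Q odd_l R ιX hopen σ K' constEmb constEmb_injective hdivc hdivp).N u : Aut A) = ((ofBiKummerData h toB Q odd_l R ιX hopen σ K' constEmb constEmb_injective hdivc hdivp).muTorsionPull (Ψ.functor.map φ) (ofBiKummerData h toB Q odd_l R ιX hopen σ K' constEmb constEmb_injective hdivc hdivp).N ⟨_, hu⟩ : Aut (Ψ.functor.obj A)))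
    -- the NORMALISED Thm 5.7 transport (D_c = 1, e = 1: abc-iut-L2-d4 T1 + abc-iut-w5-d245 `capCupTransport_normalise`)
    (α : Ψ.functor.obj (ofBiKummerData h toB Q odd_l R ιX hopen σ K' constEmb constEmb_injective hdivc hdivp).AN ≅ (ofBiKummerData h toB Q odd_l R ιX hopen σ K' constEmb constEmb_injective hdivc hdivp).AN) (β : Ψ.functor.obj (ofBiKummerData h toB Q odd_l R ιX hopen σ K' constEmb constEmb_injective hdivc hdivp).BN ≅ (ofBiKummerData h toB Q odd_l R ιX hopen σ K' constEmb constEmb_injective hdivc hdivp).BN) {Dp₀ : Aut (ofBiKummerData h toB Q odd_l R ιX hopen σ K' constEmb constEmb_injective hdivc hdivp).BN}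
    (hc₁ : α.inv ≫ Ψ.functor.map (ofBiKummerData h toB Q odd_l R ιX hopen σ K' constEmb constEmb_injective hdivc hdivp).sCap ≫ β.hom = (ofBiKummerData h toB Q odd_l R ιX hopen σ K' constEmb constEmb_injective hdivc hdivp).sCap)
    (hp₁ : α.inv ≫ Ψ.functor.map (ofBiKummerData h toB Q odd_l R ιX hopen σ K' constEmb constEmb_injective hdivc hdivp).sCup ≫ β.hom = (ofBiKummerData h toB Q odd_l R ιX hopen σ K' constEmb constEmb_injective hdivc hdivp).sCup ≫ Dp₀.hom) (hDp₀ : Dp₀ ∈ (ofBiKummerData h toB Q odd_l R ιX hopen σ K' constEmb constEmb_injective hdivc hdivp).units (ofBiKummerData h toB Q odd_l R ιX hopen σ K' constEmb constEmb_injective hdivc hdivp).BN)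
    -- [FrdI] Prop 5.6 / Thm 3.4 (iii) data at A_N (abc-iut-w5-d245's Prop 5.6 unit)
    (φ : ℕ+ →* End R.AN)
    (hφ : ∀ n : ℕ+, PreFrobenioid.degFr S.F (End.asHom (φ n)) = n ∧
      PreFrobenioid.IsBaseIdentity S.F (End.asHom (φ n)) ∧ PreFrobenioid.IsFrobeniusType S.F (End.asHom (φ n)))
    (hc : ∀ (n : ℕ+) (g : Aut R.AN.base), (σ g).hom ≫ End.asHom (φ n) = End.asHom (φ n) ≫ (σ g).hom)
    -- the base shadow θ of Ψ through α and the Frobenius transport of Ψ at A_N EXIST ([EtTh] Thm 4.4 (i), [FrdI] Thm 3.4 (iii)):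
    -- ONE binder = VERBATIM the conclusion of abc-iut-w5-d245's `exists_psiTransportData_ofBiKummerData` (p428815),
    -- discharged by that single term in the sequel `…V3Model.lean` once its module is built
    (hpsi : ∃ (θ : Aut R.AN.base ≃* Aut R.AN.base) (ΨN : ℕ+ ≃* ℕ+),
      (∀ f : Aut R.AN, (PreFrobenioid.baseFunctor S.F).mapIso (α.symm ≪≫ Ψ.functor.mapIso f ≪≫ α) =
        θ ((PreFrobenioid.baseFunctor S.F).mapIso f)) ∧
      (∀ f : R.AN ⟶ R.AN, PreFrobenioid.degFr S.F (α.inv ≫ Ψ.functor.map f ≫ α.hom) = ΨN (PreFrobenioid.degFr S.F f)) ∧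
      (∀ f : R.AN ⟶ R.AN, PreFrobenioid.IsBaseIdentity S.F f →
        PreFrobenioid.IsBaseIdentity S.F (α.inv ≫ Ψ.functor.map f ≫ α.hom)) ∧
      (∀ f : R.AN ⟶ R.AN, PreFrobenioid.IsFrobeniusType S.F f →
        PreFrobenioid.IsFrobeniusType S.F (α.inv ≫ Ψ.functor.map f ≫ α.hom)))
    -- Prop 2.4 / T56-L02 / T56-L09c for the Galois shadow of the PRODUCED base shadow of `Ψ` through `α`
    (hΓ : ∀ θA : Aut R.AN.base ≃* Aut R.AN.base,
      (∀ f : Aut R.AN, (PreFrobenioid.baseFunctor S.F).mapIso (α.symm ≪≫ Ψ.functor.mapIso f ≪≫ α) =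
        θA ((PreFrobenioid.baseFunctor S.F).mapIso f)) →
      ∃ γ : RD.PiX ≃ₜ* RD.PiX,
        (∀ y : RD.PiX, (((ofBiKummerData h toB Q odd_l R ιX hopen σ K' constEmb constEmb_injective hdivc hdivp).autBaseIsoAB.symm.trans θA).trans (ofBiKummerData h toB Q odd_l R ιX hopen σ K' constEmb constEmb_injective hdivc hdivp).autBaseIsoAB) (rhoOfBiKummerData R ιX y) =
          rhoOfBiKummerData R ιX (γ y)) ∧
        RD.PiYdd.map γ.toMulEquiv.toMonoidHom = RD.PiYdd ∧
        RD.lDeltaTheta.map γ.toMulEquiv.toMonoidHom = RD.lDeltaTheta ∧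
        ∀ (k : RD.PiYdd) (hk : (k : RD.PiX) ∈ RD.lDeltaTheta) (hk' : γ k ∈ RD.lDeltaTheta),
          (ofBiKummerData h toB Q odd_l R ιX hopen σ K' constEmb constEmb_injective hdivc hdivp).lDeltaModNMap β.hom (aΨ _ (e (RD.thetaMod ⟨k, hk⟩))) = e (RD.thetaMod ⟨γ k, hk'⟩)) :
    ∃ ρ : RigidityFamily (ofBiKummerData h toB Q odd_l R ιX hopen σ K' constEmb constEmb_injective hdivc hdivp), IsKummerDetermined (ofBiKummerData h toB Q odd_l R ιX hopen σ K' constEmb constEmb_injective hdivc hdivp) P ρ hB ∧ IsFunctorialLinear (ofBiKummerData h toB Q odd_l R ιX hopen σ K' constEmb constEmb_injective hdivc hdivp) ρ ∧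
      (∀ ρ' : RigidityFamily (ofBiKummerData h toB Q odd_l R ιX hopen σ K' constEmb constEmb_injective hdivc hdivp), IsKummerDetermined (ofBiKummerData h toB Q odd_l R ιX hopen σ K' constEmb constEmb_injective hdivc hdivp) P ρ' hB → IsFunctorialLinear (ofBiKummerData h toB Q odd_l R ιX hopen σ K' constEmb constEmb_injective hdivc hdivp) ρ' → ρ' = ρ) ∧
      CyclotomicRigidityPreserved (ofBiKummerData h toB Q odd_l R ιX hopen σ K' constEmb constEmb_injective hdivc hdivp) Ψ ρ aΨ := by
  have hKR := hKR_ofBiKummerData_of_dictionary h toB Q odd_l R ιX hopen σ K' constEmb constEmb_injective hdivc hdivp hσ hfrac P H m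
    hYddI hη₀ (hcompat hYddI) hχX hcovHB
  exact exists_rigidityFamily_unique_preserved_ofBiKummerData_of_leaves_model h toB Q odd_l R ιX hopen σ K' constEmb
    constEmb_injective hdivc hdivp hB P hη₀ hdies e he hpre hP hcov' ν hKν hσ hgeom hP34 hΔcnst hreach hLc hLi hGalT hproj hKR hH
    hfrac haut Ψ Ψbs eΨ aΨ hlin haΨn hpull α β hc₁ hp₁ hDp₀ φ hφ hc hpsi hΓ

end Data

end ThetaFrobenioid

end Literature.AnabelianGeometry.EtaleTheta

end
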